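import Literature.Probability.RandomPlanarGeometry.SLEImageLocalisationCell
import HarnessLib

/-!
# The localised image driving function of SLE₆ is a martingale, I: the cell estimate ([LSW 2001] Thm. 2.2)

G. F. Lawler, O. Schramm, W. Werner, Acta Math. **187** (2001), Thm. 2.2 and *Conformal restriction:
the chordal case* (2003), §5, remark after (5.1): along the SLE_κ hulls and a `*`-hull `A` not yet
reached, the image driving value `W̃_t = h_t(W_t) = W_t + L_A − L_{B_t}` satisfies
`dW̃ = h_t'(W_t) dW_t + (κ/2 − 3) h_t''(W_t) dt`; **at `κ = 6` the drift vanishes and `W̃` is a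
continuous local martingale.** For the process `Mⁿ = imgMartK 6 hA hne n` of `SLEImageLocalisation`
(`W̃` stopped at the localising time `T = imgLocTimeK n`) this file proves the CELL ESTIMATE of the
conditional-increment scheme of `SLERestrictionLocalMartingaleKappa`: over a cell `[u, u + h]`,
`𝟙_S (Mⁿ_{u+h} − Mⁿ_u)` splits (`indicator_imgMartK_sub_eq`) into the conditional one-step term
`g (imageDrvFnK_{u+h} − imageDrvFnK_u)` with the `𝓕_u`-measurable weight `g = 𝟙_S 𝟙{u < T}`, of
expectation `O(h^{3/2})` by `exists_abs_integral_mul_imageDrv_sub_le` (`SLEImageDriverIncrement`, where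
`κ = 6` enters), and a defect supported on `{u < T}` which vanishes unless `T ∈ (u, u+h)` (then
`≤ 50h/ρ₀ + 4κ₀` off the event of driver oscillation `≥ κ₀`, `abs_imgMartK_sub_sub_le`) or the
oscillation is large (probability `O(h²)`; the unbounded defect is then controlled through the fourth
moment of the running supremum, `integral_indicator_oscFn_mul_runSup_le`): `abs_imgDefect_le`,
`abs_setIntegral_imgCell_le`. The summation over a partition and the martingale property are the sequel
`SLEImageMartingale`.

## References

* G. F. Lawler, O. Schramm, W. Werner, Acta Math. **187** (2001), Thm. 2.2. [LawlerSchrammWerner2001]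
* [LSW] 2003, §5 (remark after (5.1)). [LawlerSchrammWerner2003Restriction]
-/

noncomputable section

open Set Filter Metric Function MeasureTheory ProbabilityTheory
open _root_.Complex _root_.Topology
open Literature.Probability.Process (brownian preWienerMeasure runSup)
open scoped NNReal

namespace Literature.Probability.RandomPlanarGeometry

open Loewner PathOps

variable {A : Set ℂ} {hA : IsStarHull A} {hne : A.Nonempty} {n : ℕ}

/-! ### The cell decomposition, pathwise -/

section Pathwise

/-- **The cell decomposition**: with `g = 𝟙_S 𝟙{u < T}`,
`𝟙_S (Mⁿ_{u+h} − Mⁿ_u) = g (Φ_{u+h} − Φ_u) + g ((Mⁿ_{u+h} − Mⁿ_u) − (Φ_{u+h} − Φ_u))`, `Φ_t = imageDrvFnK κ A t ∘ β`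
(after `T` the stopped process is frozen). [folklore] -/
theorem indicator_imgMartK_sub_eq {κ : ℝ≥0} (S : Set (ℝ≥0 → ℝ)) (u h : ℝ≥0) (ω : ℝ≥0 → ℝ) :
    S.indicator (fun ω ↦ imgMartK κ hA hne n (u + h) ω - imgMartK κ hA hne n u ω) ω =
      (S.indicator (fun _ ↦ (1 : ℝ)) ω * {ω | (u : WithTop ℝ≥0) < imgLocTimeK κ hA hne n ω}.indicator (fun _ ↦ (1 : ℝ)) ω) *
          (imageDrvFnK κ A (u + h) (brownianCPath ω) - imageDrvFnK κ A u (brownianCPath ω)) +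
        (S.indicator (fun _ ↦ (1 : ℝ)) ω * {ω | (u : WithTop ℝ≥0) < imgLocTimeK κ hA hne n ω}.indicator (fun _ ↦ (1 : ℝ)) ω) *
          ((imgMartK κ hA hne n (u + h) ω - imgMartK κ hA hne n u ω) -
            (imageDrvFnK κ A (u + h) (brownianCPath ω) - imageDrvFnK κ A u (brownianCPath ω))) := by
  by_cases h1 : ω ∈ S
  · rw [Set.indicator_of_mem h1, Set.indicator_of_mem h1]
    by_cases h2 : (u : WithTop ℝ≥0) < imgLocTimeK κ hA hne n ω
    · rw [Set.indicator_of_mem (show ω ∈ {ω | (u : WithTop ℝ≥0) < imgLocTimeK κ hA hne n ω} from h2)]; ring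
    · rw [Set.indicator_of_notMem (show ω ∉ {ω | (u : WithTop ℝ≥0) < imgLocTimeK κ hA hne n ω} from h2)]
      obtain ⟨T₀, hT₀⟩ := WithTop.ne_top_iff_exists.1 (imgLocTimeK_ne_top (κ := κ) (hA := hA) (hne := hne) n ω)
      have hTu : T₀ ≤ u := by
        have := not_lt.1 h2; rw [← hT₀] at this; exact_mod_cast this
      rw [imgMartK_eq_of_ge hT₀.symm (hTu.trans le_self_add), imgMartK_eq_of_ge hT₀.symm hTu]; ring
  · rw [Set.indicator_of_notMem h1, Set.indicator_of_notMem h1]; ring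

/-- **The defect of the cell, pointwise.** On `{u < T}`, with `A ⊆ B̄(0, R)`, `u ≤ t₁`, `h ≤ 1`, a threshold
`κ₀ > 0` with `stepSize κ₀ h ≤ cₙ (cₙ/16)/1000`, `Bad = {κ₀/√6 ≤ osc_h(incr_u β)}`, `E = {u < T < u + h}`:
`|(Mⁿ_{u+h} − Mⁿ_u) − (Φ_{u+h} − Φ_u)| ≤ 𝟙_E (50h/(cₙ/16) + 4κ₀) + (2N₀ + Q) 𝟙_Bad + M₁ 𝟙_Bad runSup (u+h)`,
with `N₀` the bound of `Mⁿ` (`abs_imgMartK_le`), `Q = 15080 √(t₁+1) + 1160 R`, `M₁ = 3482 √6` (envelope of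
the increment, `abs_imageDrvFnK_brownianCPath_sub_le`). [folklore] -/
theorem abs_imgDefect_le {R : ℝ} (hR0 : 0 < R) (hAR : A ⊆ closedBall (0 : ℂ) R) {u h t₁ : ℝ≥0} (hut : u ≤ t₁)
    (hh0 : 0 < h) (hh1 : (h : ℝ) ≤ 1) {κ₀ : ℝ} (hκ₀ : 0 < κ₀) (hh2 : stepSize κ₀ h ≤ locLevel n * (locLevel n / 16) / 1000)
    {ω : ℝ≥0 → ℝ} (hu : (u : WithTop ℝ≥0) < imgLocTimeK 6 hA hne n ω) :
    |(imgMartK 6 hA hne n (u + h) ω - imgMartK 6 hA hne n u ω) -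
        (imageDrvFnK 6 A (u + h) (brownianCPath ω) - imageDrvFnK 6 A u (brownianCPath ω))| ≤
      {ω | (u : WithTop ℝ≥0) < imgLocTimeK 6 hA hne n ω ∧ imgLocTimeK 6 hA hne n ω < ((u + h : ℝ≥0) : WithTop ℝ≥0)}.indicator
          (fun _ ↦ 50 * (h : ℝ) / (locLevel n / 16) + 4 * κ₀) ω +
        (2 * (((n : ℝ) + 1) + 1160 * (3 * ((n : ℝ) + 1) + 13 * Real.sqrt ((n : ℝ) + 1) + R)) +
            (15080 * Real.sqrt ((t₁ : ℝ) + 1) + 1160 * R)) *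
          {ω | κ₀ / Real.sqrt 6 ≤ oscFn h (incr u (brownianCPath ω))}.indicator (fun _ ↦ (1 : ℝ)) ω +
        3482 * Real.sqrt 6 * ({ω | κ₀ / Real.sqrt 6 ≤ oscFn h (incr u (brownianCPath ω))}.indicator (fun _ ↦ (1 : ℝ)) ω *
          runSup (u + h) ω) := by
  have hc0 := (locLevel_pos_le n).1
  have h6 : (0 : ℝ) < Real.sqrt 6 := Real.sqrt_pos.2 (by norm_num)
  have hX0 : 0 ≤ runSup (u + h) ω := Process.runSup_nonneg _ ω
  have hD0 : 0 ≤ 50 * (h : ℝ) / (locLevel n / 16) + 4 * κ₀ := by positivity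
  have hE0 : 0 ≤ {ω | (u : WithTop ℝ≥0) < imgLocTimeK 6 hA hne n ω ∧ imgLocTimeK 6 hA hne n ω < ((u + h : ℝ≥0) : WithTop ℝ≥0)}.indicator
      (fun _ ↦ 50 * (h : ℝ) / (locLevel n / 16) + 4 * κ₀) ω := Set.indicator_nonneg (fun _ _ ↦ hD0) ω
  have hN₀0 : 0 ≤ ((n : ℝ) + 1) + 1160 * (3 * ((n : ℝ) + 1) + 13 * Real.sqrt ((n : ℝ) + 1) + R) := by positivity
  have hQ0 : 0 ≤ 15080 * Real.sqrt ((t₁ : ℝ) + 1) + 1160 * R := by positivity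
  by_cases hbad : ω ∈ {ω | κ₀ / Real.sqrt 6 ≤ oscFn h (incr u (brownianCPath ω))}
  · -- large oscillation: the crude bound
    rw [Set.indicator_of_mem hbad, mul_one, one_mul]
    have e1 : |imgMartK 6 hA hne n (u + h) ω - imgMartK 6 hA hne n u ω| ≤
        2 * (((n : ℝ) + 1) + 1160 * (3 * ((n : ℝ) + 1) + 13 * Real.sqrt ((n : ℝ) + 1) + R)) := by
      calc _ ≤ |imgMartK 6 hA hne n (u + h) ω| + |imgMartK 6 hA hne n u ω| := abs_sub _ _
        _ ≤ _ := by have := abs_imgMartK_le (κ := 6) (hA := hA) (hne := hne) (n := n) hR0 hAR (u + h) ω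
                    have := abs_imgMartK_le (κ := 6) (hA := hA) (hne := hne) (n := n) hR0 hAR u ω; linarith
    have e2 : |imageDrvFnK 6 A (u + h) (brownianCPath ω) - imageDrvFnK 6 A u (brownianCPath ω)| ≤
        3482 * Real.sqrt 6 * runSup (u + h) ω + (15080 * Real.sqrt ((t₁ : ℝ) + 1) + 1160 * R) := by
      have := abs_imageDrvFnK_brownianCPath_sub_le hA hR0 hAR u h ω
      have hsq : Real.sqrt ((u + h : ℝ≥0) : ℝ) ≤ Real.sqrt ((t₁ : ℝ) + 1) :=
        Real.sqrt_le_sqrt (by push_cast; exact add_le_add (by exact_mod_cast hut) hh1)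
      linarith [mul_le_mul_of_nonneg_left hsq (by norm_num : (0 : ℝ) ≤ 15080)]
    calc _ ≤ |imgMartK 6 hA hne n (u + h) ω - imgMartK 6 hA hne n u ω| +
          |imageDrvFnK 6 A (u + h) (brownianCPath ω) - imageDrvFnK 6 A u (brownianCPath ω)| := abs_sub _ _
      _ ≤ _ := by linarith
  · -- small oscillation: the boundary-cell estimate
    rw [Set.indicator_of_notMem hbad, mul_zero, zero_mul, mul_zero, add_zero, add_zero]
    have hosc : oscFn h (incr u (brownianCPath ω)) < κ₀ / Real.sqrt 6 := not_le.1 hbad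
    have hS' : ∀ r : ℝ≥0, r ≤ h → |drvK 6 (brownianCPath ω) (u + r) - drvK 6 (brownianCPath ω) u| ≤ κ₀ := fun r hr ↦ by
      have h1' := abs_incr_le_oscFn hr u (brownianCPath ω)
      have : drvK 6 (brownianCPath ω) (u + r) - drvK 6 (brownianCPath ω) u =
          Real.sqrt 6 * ((brownianCPath ω) (u + r) - (brownianCPath ω) u) := by
        simp only [drvK]; push_cast; ring
      rw [this, abs_mul, abs_of_nonneg h6.le]
      exact ((lt_div_iff₀' h6).1 (lt_of_le_of_lt h1' hosc)).le
    obtain ⟨hz, hbd⟩ := abs_imgMartK_sub_sub_le (κ := 6) hu hh0 hS' hh2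
    rcases le_or_gt (((u + h : ℝ≥0) : WithTop ℝ≥0)) (imgLocTimeK 6 hA hne n ω) with hle | hlt
    · rw [hz hle, abs_zero]; exact hE0
    · rw [Set.indicator_of_mem (show ω ∈ {ω | (u : WithTop ℝ≥0) < imgLocTimeK 6 hA hne n ω ∧
        imgLocTimeK 6 hA hne n ω < ((u + h : ℝ≥0) : WithTop ℝ≥0)} from ⟨hu, hlt⟩)]
      exact hbd

end Pathwise

/-! ### Integrating a three-term indicator bound -/

section Integrate

/-- **Integrating a three-term indicator bound**: if `|b| ≤ 𝟙_E D + a₁ 𝟙_B + a₂ 𝟙_B X` pointwise with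
`b`, `𝟙_B X` integrable and `D, a₁, a₂ ≥ 0`, then `|∫ b| ≤ D P(E) + a₁ P(B) + a₂ ∫ 𝟙_B X`. [folklore] -/
theorem abs_integral_le_of_three_indicator {E B : Set (ℝ≥0 → ℝ)} (hEm : MeasurableSet E) (hBm : MeasurableSet B)
    {b X : (ℝ≥0 → ℝ) → ℝ} (ib : Integrable b preWienerMeasure)
    (iX : Integrable (fun ω ↦ B.indicator (fun _ ↦ (1 : ℝ)) ω * X ω) preWienerMeasure) {D a₁ a₂ : ℝ}
    (hpt : ∀ ω, |b ω| ≤ E.indicator (fun _ ↦ D) ω + a₁ * B.indicator (fun _ ↦ (1 : ℝ)) ω + a₂ * (B.indicator (fun _ ↦ (1 : ℝ)) ω * X ω)) :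
    |∫ ω, b ω ∂preWienerMeasure| ≤ D * preWienerMeasure.real E + a₁ * preWienerMeasure.real B +
      a₂ * ∫ ω, B.indicator (fun _ ↦ (1 : ℝ)) ω * X ω ∂preWienerMeasure := by
  haveI := isProbabilityMeasure_preWienerMeasure'
  have iE : Integrable (E.indicator fun _ ↦ D) preWienerMeasure := (integrable_const D).indicator hEm
  have iB : Integrable (B.indicator fun _ ↦ (1 : ℝ)) preWienerMeasure := (integrable_const (1 : ℝ)).indicator hBm
  have iRHS : Integrable (fun ω ↦ E.indicator (fun _ ↦ D) ω + a₁ * B.indicator (fun _ ↦ (1 : ℝ)) ω +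
      a₂ * (B.indicator (fun _ ↦ (1 : ℝ)) ω * X ω)) preWienerMeasure := (iE.add (iB.const_mul _)).add (iX.const_mul _)
  calc |∫ ω, b ω ∂preWienerMeasure| ≤ ∫ ω, |b ω| ∂preWienerMeasure := abs_integral_le_integral_abs
    _ ≤ ∫ ω, (E.indicator (fun _ ↦ D) ω + a₁ * B.indicator (fun _ ↦ (1 : ℝ)) ω + a₂ * (B.indicator (fun _ ↦ (1 : ℝ)) ω * X ω))
          ∂preWienerMeasure := integral_mono ib.abs iRHS hpt
    _ = _ := by
        have iA : Integrable (fun ω ↦ E.indicator (fun _ ↦ D) ω + a₁ * B.indicator (fun _ ↦ (1 : ℝ)) ω) preWienerMeasure :=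
          iE.add (iB.const_mul _)
        have iC : Integrable (fun ω ↦ a₂ * (B.indicator (fun _ ↦ (1 : ℝ)) ω * X ω)) preWienerMeasure := iX.const_mul _
        have iB' : Integrable (fun ω ↦ a₁ * B.indicator (fun _ ↦ (1 : ℝ)) ω) preWienerMeasure := iB.const_mul _
        rw [integral_add iA iC, integral_add iE iB', integral_const_mul, integral_const_mul, integral_indicator_const _ hEm,
          integral_indicator_const _ hBm]
        simp [smul_eq_mul, mul_comm]

/-- Elementary: `√6⁴ = 36`, so `128 h²/(κ₀/√6)⁴ = 4608 h²/κ₀⁴`. [folklore] -/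
theorem oscTail_const_eq (h κ₀ : ℝ) : 128 * h ^ 2 / (κ₀ / Real.sqrt 6) ^ 4 = 4608 * h ^ 2 / κ₀ ^ 4 := by
  have h36 : Real.sqrt 6 ^ 4 = 36 := by
    rw [show Real.sqrt 6 ^ 4 = (Real.sqrt 6 ^ 2) ^ 2 by ring, Real.sq_sqrt (by norm_num : (0 : ℝ) ≤ 6)]; norm_num
  rw [div_pow, h36]
  rcases eq_or_ne κ₀ 0 with rfl | hk
  · simp
  · field_simp; ring

/-- Elementary: for `0 < h ≤ 1`, `h² ≤ h √h`, `(1/√h) h² = h √h` and `(1/√h)⁻³ = h √h`. [folklore] -/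
theorem sqrt_cell_arith {h : ℝ} (hh0 : 0 < h) (hh1 : h ≤ 1) :
    h ^ 2 ≤ h * Real.sqrt h ∧ 1 / Real.sqrt h * h ^ 2 = h * Real.sqrt h ∧ 1 / (1 / Real.sqrt h) ^ 3 = h * Real.sqrt h := by
  have hsh : 0 < Real.sqrt h := Real.sqrt_pos.2 hh0
  have hss : Real.sqrt h * Real.sqrt h = h := Real.mul_self_sqrt hh0.le
  have hsq1 : Real.sqrt h ≤ 1 := by rw [← Real.sqrt_one]; exact Real.sqrt_le_sqrt hh1
  refine ⟨?_, ?_, ?_⟩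
  · have : h ≤ Real.sqrt h := by
      have := mul_le_mul_of_nonneg_left hsq1 hsh.le
      rwa [hss, mul_one] at this
    nlinarith
  · field_simp
    nlinarith [hss]
  · rw [div_pow, one_pow, one_div_one_div, show (3 : ℕ) = 2 + 1 from rfl, pow_succ, Real.sq_sqrt hh0.le]

end Integrate

/-! ### The integral over one cell -/

section Cell

variable [MeasurableSpace C(ℝ≥0, ℝ)] [BorelSpace C(ℝ≥0, ℝ)]

/-- **The cell estimate in expectation.** Let `C` be a constant of the one-step estimate
`exists_abs_integral_mul_imageDrv_sub_le` at `(δ₀, ρ₀) = (cₙ, cₙ/8)` with horizon `t₁`, let `A ⊆ B̄(0, R)`.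
For `s ≤ u ≤ t₁`, `S ∈ 𝓕_s`, a threshold `κ₀ > 0` and a small step `h ≤ 1`:
`|∫_S (Mⁿ_{u+h} − Mⁿ_u)| ≤ C h√h + (50h/(cₙ/16) + 4κ₀) P(u < T < u+h) + K h√h`, with `K = K(n, R, t₁, κ₀)`
explicit. [cite: LawlerSchrammWerner2001, Thm. 2.2] -/
theorem abs_setIntegral_imgCell_le (hA : IsStarHull A) (hne : A.Nonempty) {R : ℝ} (hR0 : 0 < R) (hAR : A ⊆ closedBall (0 : ℂ) R)
    {t₁ : ℝ≥0} {C : ℝ}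
    (hC : ∀ (u h : ℝ≥0), u ≤ t₁ → 0 < h → 192 * (h : ℝ) ≤ (locLevel n * (locLevel n / 8) / 4000) ^ 2 →
      ∀ {g : (ℝ≥0 → ℝ) → ℝ}, Measurable[brownianFiltration u] g → (∀ ω, g ω ∈ Icc (0 : ℝ) 1) →
        (∀ ω, g ω ≠ 0 → Disjoint (closedHull (drvK 6 (brownianCPath ω)) u) A ∧
          Disjoint (ball (0 : ℂ) (8 * (locLevel n / 8))) (slidHull (drvK 6 (brownianCPath ω)) A u) ∧
            locLevel n ≤ starDeriv (slidHull (drvK 6 (brownianCPath ω)) A u)) →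
        |∫ ω, g ω * (imageDrvFnK 6 A (u + h) (brownianCPath ω) - imageDrvFnK 6 A u (brownianCPath ω)) ∂preWienerMeasure| ≤
          C * h * Real.sqrt h)
    {s u h : ℝ≥0} (hsu : s ≤ u) (hut : u ≤ t₁) {S : Set (ℝ≥0 → ℝ)} (hS : MeasurableSet[brownianFiltration s] S)
    {κ₀ : ℝ} (hκ₀ : 0 < κ₀) (hh0 : 0 < h) (hh1 : (h : ℝ) ≤ 1)
    (hhc : 192 * (h : ℝ) ≤ (locLevel n * (locLevel n / 8) / 4000) ^ 2)
    (hh2 : stepSize κ₀ h ≤ locLevel n * (locLevel n / 16) / 1000)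
    (hh4 : (h : ℝ) ≤ (κ₀ / Real.sqrt 6 / 2) ^ 2 / 2) :
    |∫ ω in S, (imgMartK 6 hA hne n (u + h) ω - imgMartK 6 hA hne n u ω) ∂preWienerMeasure| ≤
      C * h * Real.sqrt h +
        (50 * h / (locLevel n / 16) + 4 * κ₀) *
          preWienerMeasure.real {ω | (u : WithTop ℝ≥0) < imgLocTimeK 6 hA hne n ω ∧
            imgLocTimeK 6 hA hne n ω < ((u + h : ℝ≥0) : WithTop ℝ≥0)} +
        ((2 * (((n : ℝ) + 1) + 1160 * (3 * ((n : ℝ) + 1) + 13 * Real.sqrt ((n : ℝ) + 1) + R)) +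
            (15080 * Real.sqrt ((t₁ : ℝ) + 1) + 1160 * R) + 3482 * Real.sqrt 6) * (4608 / κ₀ ^ 4) +
          3482 * Real.sqrt 6 * (18 * ((t₁ : ℝ) + 1) ^ 2)) * h * Real.sqrt h := by
  haveI := isProbabilityMeasure_preWienerMeasure'
  obtain ⟨hc0, hc1⟩ := locLevel_pos_le n
  have hSm : MeasurableSet S := brownianFiltration.le s _ hS
  obtain ⟨hEgt_u, hEgt, hElt⟩ := measurableSet_lt_imgLocTimeK (κ := 6) (hA := hA) (hne := hne) n u (u + h)
  -- abbreviations (plain `have`-level constants)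
  have hN₀0 : 0 ≤ ((n : ℝ) + 1) + 1160 * (3 * ((n : ℝ) + 1) + 13 * Real.sqrt ((n : ℝ) + 1) + R) := by positivity
  have hQ0 : 0 ≤ 15080 * Real.sqrt ((t₁ : ℝ) + 1) + 1160 * R := by positivity
  have hM₁0 : (0 : ℝ) ≤ 3482 * Real.sqrt 6 := by positivity
  -- the weight
  set g0 : (ℝ≥0 → ℝ) → ℝ := fun ω ↦ S.indicator (fun _ ↦ (1 : ℝ)) ω *
    {ω | (u : WithTop ℝ≥0) < imgLocTimeK 6 hA hne n ω}.indicator (fun _ ↦ (1 : ℝ)) ω with hg0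
  have hg0mu : Measurable[brownianFiltration u] g0 :=
    ((measurable_const (a := (1 : ℝ))).indicator (brownianFiltration.mono hsu _ hS)).mul
      ((measurable_const (a := (1 : ℝ))).indicator hEgt_u)
  have hg0m : Measurable g0 := hg0mu.mono (brownianFiltration.le u) le_rfl
  have hg0_01 : ∀ ω, g0 ω = 0 ∨ g0 ω = 1 := fun ω ↦ by
    rw [hg0]; simp only
    by_cases h1 : ω ∈ S
    · by_cases h2 : ω ∈ {ω | (u : WithTop ℝ≥0) < imgLocTimeK 6 hA hne n ω}
      · rw [Set.indicator_of_mem h1, Set.indicator_of_mem h2]; norm_num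
      · rw [Set.indicator_of_mem h1, Set.indicator_of_notMem h2]; norm_num
    · rw [Set.indicator_of_notMem h1, zero_mul]; exact Or.inl rfl
  have hg01 : ∀ ω, g0 ω ∈ Icc (0 : ℝ) 1 := fun ω ↦ by
    rcases hg0_01 ω with h | h <;> rw [h] <;> norm_num
  have hg0T : ∀ ω, g0 ω ≠ 0 → (u : WithTop ℝ≥0) < imgLocTimeK 6 hA hne n ω := fun ω hω ↦ by
    by_contra hnot
    exact hω (by rw [hg0]; simp only
                 rw [Set.indicator_of_notMem (show ω ∉ {ω | (u : WithTop ℝ≥0) < imgLocTimeK 6 hA hne n ω} from hnot), mul_zero])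
  -- the defect
  set b : (ℝ≥0 → ℝ) → ℝ := fun ω ↦ g0 ω * ((imgMartK 6 hA hne n (u + h) ω - imgMartK 6 hA hne n u ω) -
    (imageDrvFnK 6 A (u + h) (brownianCPath ω) - imageDrvFnK 6 A u (brownianCPath ω))) with hb
  have hdec : ∀ ω, S.indicator (fun ω ↦ imgMartK 6 hA hne n (u + h) ω - imgMartK 6 hA hne n u ω) ω =
      g0 ω * (imageDrvFnK 6 A (u + h) (brownianCPath ω) - imageDrvFnK 6 A u (brownianCPath ω)) + b ω := fun ω ↦
    indicator_imgMartK_sub_eq S u h ω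
  -- integrability
  obtain ⟨hΦm, iΦ, -⟩ := integrable_imageDrv_sub hA (measurable_imageDrvFnK 6 hA hne) hR0 hAR u h
  have hg0' : ∀ᵐ ω ∂preWienerMeasure, ‖g0 ω‖ ≤ 1 := Eventually.of_forall fun ω ↦ by
    rw [Real.norm_eq_abs, abs_of_nonneg (hg01 ω).1]; exact (hg01 ω).2
  have i1 : Integrable (fun ω ↦ g0 ω * (imageDrvFnK 6 A (u + h) (brownianCPath ω) - imageDrvFnK 6 A u (brownianCPath ω)))
      preWienerMeasure := iΦ.bdd_mul hg0m.aestronglyMeasurable hg0'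
  have iM : Integrable (fun ω ↦ imgMartK 6 hA hne n (u + h) ω - imgMartK 6 hA hne n u ω) preWienerMeasure :=
    (integrable_imgMartK n _).sub (integrable_imgMartK n _)
  have i2 : Integrable b preWienerMeasure := by
    have : b = fun ω ↦ S.indicator (fun ω ↦ imgMartK 6 hA hne n (u + h) ω - imgMartK 6 hA hne n u ω) ω -
        g0 ω * (imageDrvFnK 6 A (u + h) (brownianCPath ω) - imageDrvFnK 6 A u (brownianCPath ω)) := by
      funext ω; rw [hdec ω]; ring
    rw [this]
    exact (iM.indicator hSm).sub i1
  have hsplit : ∫ ω in S, (imgMartK 6 hA hne n (u + h) ω - imgMartK 6 hA hne n u ω) ∂preWienerMeasure =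
      ∫ ω, g0 ω * (imageDrvFnK 6 A (u + h) (brownianCPath ω) - imageDrvFnK 6 A u (brownianCPath ω)) ∂preWienerMeasure +
        ∫ ω, b ω ∂preWienerMeasure := by
    rw [← integral_indicator hSm, ← integral_add i1 i2]
    exact integral_congr_ae (Eventually.of_forall hdec)
  rw [hsplit]
  -- (I) the conditional one-step term
  have hI : |∫ ω, g0 ω * (imageDrvFnK 6 A (u + h) (brownianCPath ω) - imageDrvFnK 6 A u (brownianCPath ω)) ∂preWienerMeasure| ≤
      C * h * Real.sqrt h := by
    refine hC u h hut hh0 hhc hg0mu hg01 fun ω hω ↦ ?_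
    obtain ⟨halive, -, -, hd, hm⟩ := controlled_of_lt_locTimeK (lt_of_lt_of_le (hg0T ω hω) (imgLocTimeK_le_locTimeK n ω))
    refine ⟨halive, ?_, hd.le⟩
    rw [show 8 * (locLevel n / 8) = locLevel n by ring]
    exact disjoint_ball_infDist.mono_left (ball_subset_ball hm.le)
  -- (II) the defect
  have hEm : MeasurableSet {ω | (u : WithTop ℝ≥0) < imgLocTimeK 6 hA hne n ω ∧
      imgLocTimeK 6 hA hne n ω < ((u + h : ℝ≥0) : WithTop ℝ≥0)} := hEgt.inter hElt
  have hBadm : MeasurableSet {ω | κ₀ / Real.sqrt 6 ≤ oscFn h (incr u (brownianCPath ω))} :=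
    measurableSet_le measurable_const ((measurable_oscFn h).comp ((measurable_incr u).comp measurable_brownianCPath))
  have hk : 0 < κ₀ / Real.sqrt 6 := div_pos hκ₀ (Real.sqrt_pos.2 (by norm_num))
  have hl : (0 : ℝ) < 1 / Real.sqrt h := by have : (0:ℝ) < Real.sqrt h := Real.sqrt_pos.2 (by exact_mod_cast hh0); positivity
  obtain ⟨iBX, hBX⟩ := integral_indicator_oscFn_mul_runSup_le h u hk hh4 hl
  have hpt : ∀ ω, |b ω| ≤ {ω | (u : WithTop ℝ≥0) < imgLocTimeK 6 hA hne n ω ∧ imgLocTimeK 6 hA hne n ω < ((u + h : ℝ≥0) : WithTop ℝ≥0)}.indicator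
          (fun _ ↦ 50 * (h : ℝ) / (locLevel n / 16) + 4 * κ₀) ω +
        (2 * (((n : ℝ) + 1) + 1160 * (3 * ((n : ℝ) + 1) + 13 * Real.sqrt ((n : ℝ) + 1) + R)) +
            (15080 * Real.sqrt ((t₁ : ℝ) + 1) + 1160 * R)) *
          {ω | κ₀ / Real.sqrt 6 ≤ oscFn h (incr u (brownianCPath ω))}.indicator (fun _ ↦ (1 : ℝ)) ω +
        3482 * Real.sqrt 6 * ({ω | κ₀ / Real.sqrt 6 ≤ oscFn h (incr u (brownianCPath ω))}.indicator (fun _ ↦ (1 : ℝ)) ω *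
          runSup (u + h) ω) := by
    intro ω
    by_cases hg0z : g0 ω = 0
    · rw [hb]; simp only
      rw [hg0z, zero_mul, abs_zero]
      have hD0 : 0 ≤ 50 * (h : ℝ) / (locLevel n / 16) + 4 * κ₀ := by positivity
      have := Set.indicator_nonneg (fun _ _ ↦ hD0)
        (s := {ω | (u : WithTop ℝ≥0) < imgLocTimeK 6 hA hne n ω ∧ imgLocTimeK 6 hA hne n ω < ((u + h : ℝ≥0) : WithTop ℝ≥0)}) ω
      have := Set.indicator_nonneg (fun _ _ ↦ zero_le_one (α := ℝ)) (s := {ω | κ₀ / Real.sqrt 6 ≤ oscFn h (incr u (brownianCPath ω))}) ω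
      have := Process.runSup_nonneg (u + h) ω
      positivity
    · rcases hg0_01 ω with h0 | h1
      · exact absurd h0 hg0z
      rw [hb]; simp only; rw [h1, one_mul]
      exact abs_imgDefect_le hR0 hAR hut hh0 hh1 hκ₀ hh2 (hg0T ω hg0z)
  have hII := abs_integral_le_of_three_indicator hEm hBadm i2 iBX hpt
  -- arithmetic
  have hPBad : preWienerMeasure.real {ω | κ₀ / Real.sqrt 6 ≤ oscFn h (incr u (brownianCPath ω))} ≤ 4608 * (h : ℝ) ^ 2 / κ₀ ^ 4 := by
    have := measureReal_oscFn_incr_ge_le h u hk hh4; rwa [oscTail_const_eq] at this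
  rw [oscTail_const_eq] at hBX
  obtain ⟨hhs, hls, hl3⟩ := sqrt_cell_arith (h := (h : ℝ)) (by exact_mod_cast hh0) hh1
  have hhs0 : 0 ≤ (h : ℝ) * Real.sqrt h := by positivity
  have hk4 : 0 ≤ 4608 / κ₀ ^ 4 := by positivity
  have hp1 : 4608 * (h : ℝ) ^ 2 / κ₀ ^ 4 ≤ 4608 / κ₀ ^ 4 * (h * Real.sqrt h) := by
    rw [show 4608 * (h : ℝ) ^ 2 / κ₀ ^ 4 = 4608 / κ₀ ^ 4 * h ^ 2 by ring]
    exact mul_le_mul_of_nonneg_left hhs hk4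
  have huh : ((u + h : ℝ≥0) : ℝ) ^ 2 ≤ ((t₁ : ℝ) + 1) ^ 2 := by
    have huh' : ((u + h : ℝ≥0) : ℝ) ≤ (t₁ : ℝ) + 1 := by push_cast; exact add_le_add (by exact_mod_cast hut) hh1
    exact pow_le_pow_left₀ (by positivity) huh' 2
  have hJ : ∫ ω, {ω | κ₀ / Real.sqrt 6 ≤ oscFn h (incr u (brownianCPath ω))}.indicator (fun _ ↦ (1 : ℝ)) ω * runSup (u + h) ω
      ∂preWienerMeasure ≤ 4608 / κ₀ ^ 4 * (h * Real.sqrt h) + 18 * ((t₁ : ℝ) + 1) ^ 2 * (h * Real.sqrt h) := by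
    refine hBX.trans ?_
    have e1 : 1 / Real.sqrt h * (4608 * (h : ℝ) ^ 2 / κ₀ ^ 4) = 4608 / κ₀ ^ 4 * (h * Real.sqrt h) := by
      rw [← hls]; ring
    have e2 : 18 * ((u + h : ℝ≥0) : ℝ) ^ 2 / (1 / Real.sqrt h) ^ 3 = 18 * ((u + h : ℝ≥0) : ℝ) ^ 2 * (h * Real.sqrt h) := by
      rw [div_eq_mul_one_div, hl3]
    rw [e1, e2]
    nlinarith [huh, hhs0]
  have hjunk : (2 * (((n : ℝ) + 1) + 1160 * (3 * ((n : ℝ) + 1) + 13 * Real.sqrt ((n : ℝ) + 1) + R)) +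
        (15080 * Real.sqrt ((t₁ : ℝ) + 1) + 1160 * R)) *
        preWienerMeasure.real {ω | κ₀ / Real.sqrt 6 ≤ oscFn h (incr u (brownianCPath ω))} +
      3482 * Real.sqrt 6 * ∫ ω, {ω | κ₀ / Real.sqrt 6 ≤ oscFn h (incr u (brownianCPath ω))}.indicator (fun _ ↦ (1 : ℝ)) ω *
        runSup (u + h) ω ∂preWienerMeasure ≤
      ((2 * (((n : ℝ) + 1) + 1160 * (3 * ((n : ℝ) + 1) + 13 * Real.sqrt ((n : ℝ) + 1) + R)) +
            (15080 * Real.sqrt ((t₁ : ℝ) + 1) + 1160 * R) + 3482 * Real.sqrt 6) * (4608 / κ₀ ^ 4) +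
          3482 * Real.sqrt 6 * (18 * ((t₁ : ℝ) + 1) ^ 2)) * h * Real.sqrt h := by
    have a1 := mul_le_mul_of_nonneg_left (hPBad.trans hp1) (by positivity :
      (0 : ℝ) ≤ 2 * (((n : ℝ) + 1) + 1160 * (3 * ((n : ℝ) + 1) + 13 * Real.sqrt ((n : ℝ) + 1) + R)) +
        (15080 * Real.sqrt ((t₁ : ℝ) + 1) + 1160 * R))
    have a2 := mul_le_mul_of_nonneg_left hJ hM₁0
    calc _ ≤ (2 * (((n : ℝ) + 1) + 1160 * (3 * ((n : ℝ) + 1) + 13 * Real.sqrt ((n : ℝ) + 1) + R)) +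
          (15080 * Real.sqrt ((t₁ : ℝ) + 1) + 1160 * R)) * (4608 / κ₀ ^ 4 * (h * Real.sqrt h)) +
          3482 * Real.sqrt 6 * (4608 / κ₀ ^ 4 * (h * Real.sqrt h) + 18 * ((t₁ : ℝ) + 1) ^ 2 * (h * Real.sqrt h)) := add_le_add a1 a2
      _ = _ := by ring
  calc |∫ ω, g0 ω * (imageDrvFnK 6 A (u + h) (brownianCPath ω) - imageDrvFnK 6 A u (brownianCPath ω)) ∂preWienerMeasure +
        ∫ ω, b ω ∂preWienerMeasure|
      ≤ |∫ ω, g0 ω * (imageDrvFnK 6 A (u + h) (brownianCPath ω) - imageDrvFnK 6 A u (brownianCPath ω)) ∂preWienerMeasure| +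
          |∫ ω, b ω ∂preWienerMeasure| := abs_add_le _ _
    _ ≤ _ := by linarith [hI, hII, hjunk]

end Cell

end Literature.Probability.RandomPlanarGeometry

end
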